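import Mathlib
import Summits.Ventures.Crystal3D.Theorems.StickyWulffConstantTextureLiminfTentHatDefs
import HarnessLib

/-!
# The tent certificate for fcc grains — the hat functions: gauge, supports, vertex values (eng g8)

Route `StickyWulffConstant` (`Summits/Ventures/Crystal3D`, cell `crystal3d-full`), support toward the crux
`TextureLiminf` (stmt-Ventures-19483), FREE half (tent certificate, TexShadow v6.1).  For the closed-form
hat functions of `…TentHatDefs.lean` (`D₃` units):

* `cubo_eq_abs₀/₁/₂`, `cubo_eq_half` — the cuboctahedron gauge is `|y_i|` where that coordinate
  dominates (`|y_i| ≥ |y_j| + |y_k|`) and `‖y‖₁/2` otherwise;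
* `hatL_intVec_fccPoint`, `hatH_…` — vertex values (`hatL` is `1` at its own lattice point and `0` at
  every other lattice point and at every hole; `hatH` is `1` at its hole, `0` at lattice points and other
  holes); nonnegativity and the supports `hatL y > 0 → cubo y < 1`, `hatH y > 0 → ‖y‖₁ < 1`.

Affinity on chambers: `…TentHatAffine.lean`.  WHAT THIS IS NOT: the complex / the certificate; F-C1 not moved.
-/

noncomputable section

namespace Summit.Ventures.Crystal3D.TentCertificate

open Finset Summit.Ventures.Crystal3D MeasureTheory
open Literature.Geometry.DiscreteGeometry (intVec intVec_apply)
open scoped RealInnerProductSpace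

/-! ## The cuboctahedron gauge -/

/-- `cubo y = |y₀|` when the first coordinate dominates. -/
theorem cubo_eq_abs₀ {y : EuclideanSpace ℝ (Fin 3)} (h : |y 1| + |y 2| ≤ |y 0|) : cubo y = |y 0| := by
  have h1 := abs_nonneg (y 1); have h2 := abs_nonneg (y 2)
  have hm : max (max |y 0| |y 1|) |y 2| = |y 0| := by
    rw [max_eq_left (by linarith : |y 1| ≤ |y 0|), max_eq_left (by linarith : |y 2| ≤ |y 0|)]
  simp only [cubo]
  rw [hm]
  exact max_eq_left (by linarith)

/-- `cubo y = |y₁|` when the second coordinate dominates. -/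
theorem cubo_eq_abs₁ {y : EuclideanSpace ℝ (Fin 3)} (h : |y 0| + |y 2| ≤ |y 1|) : cubo y = |y 1| := by
  have h0 := abs_nonneg (y 0); have h2 := abs_nonneg (y 2)
  have hm : max (max |y 0| |y 1|) |y 2| = |y 1| := by
    rw [max_eq_right (by linarith : |y 0| ≤ |y 1|), max_eq_left (by linarith : |y 2| ≤ |y 1|)]
  simp only [cubo]
  rw [hm]
  exact max_eq_left (by linarith)

/-- `cubo y = |y₂|` when the third coordinate dominates. -/
theorem cubo_eq_abs₂ {y : EuclideanSpace ℝ (Fin 3)} (h : |y 0| + |y 1| ≤ |y 2|) : cubo y = |y 2| := by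
  have h0 := abs_nonneg (y 0); have h1 := abs_nonneg (y 1)
  have hm : max (max |y 0| |y 1|) |y 2| = |y 2| := max_eq_right (max_le (by linarith) (by linarith))
  simp only [cubo]
  rw [hm]
  exact max_eq_left (by linarith)

/-- `cubo y = ‖y‖₁ / 2` when no coordinate dominates. -/
theorem cubo_eq_half {y : EuclideanSpace ℝ (Fin 3)} (h0 : |y 0| ≤ |y 1| + |y 2|) (h1 : |y 1| ≤ |y 0| + |y 2|)
    (h2 : |y 2| ≤ |y 0| + |y 1|) : cubo y = (|y 0| + |y 1| + |y 2|) / 2 := by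
  simp only [cubo]
  refine max_eq_right (max_le (max_le ?_ ?_) ?_) <;> linarith

/-- `cubo y ≥ |y_i|`. -/
theorem abs_le_cubo (y : EuclideanSpace ℝ (Fin 3)) (i : Fin 3) : |y i| ≤ cubo y := by
  simp only [cubo]
  fin_cases i
  · exact le_trans (le_trans (le_max_left _ _) (le_max_left _ _)) (le_max_left _ _)
  · exact le_trans (le_trans (le_max_right _ _) (le_max_left _ _)) (le_max_left _ _)
  · exact le_trans (le_max_right _ _) (le_max_left _ _)

/-- `cubo y ≥ ‖y‖₁ / 2`. -/
theorem half_le_cubo (y : EuclideanSpace ℝ (Fin 3)) : (|y 0| + |y 1| + |y 2|) / 2 ≤ cubo y := by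
  simp only [cubo]; exact le_max_right _ _

/-- `cubo 0 = 0`. -/
theorem cubo_zero : cubo 0 = 0 := by simp [cubo]

/-- `hatL ≥ 0`. -/
theorem hatL_nonneg (y : EuclideanSpace ℝ (Fin 3)) : 0 ≤ hatL y := le_max_left _ _

/-- `hatH ≥ 0`. -/
theorem hatH_nonneg (y : EuclideanSpace ℝ (Fin 3)) : 0 ≤ hatH y := le_max_left _ _

/-- `hatL 0 = 1`. -/
theorem hatL_zero : hatL 0 = 1 := by simp [hatL, cubo_zero]

/-- `hatH 0 = 1`. -/
theorem hatH_zero : hatH 0 = 1 := by simp [hatH]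

/-- `hatL y = 0` as soon as `cubo y ≥ 1`. -/
theorem hatL_eq_zero_of_le {y : EuclideanSpace ℝ (Fin 3)} (h : 1 ≤ cubo y) : hatL y = 0 := by
  simp only [hatL]; exact max_eq_left (by linarith)

/-- `hatH y = 0` as soon as `‖y‖₁ ≥ 1`. -/
theorem hatH_eq_zero_of_le {y : EuclideanSpace ℝ (Fin 3)} (h : 1 ≤ |y 0| + |y 1| + |y 2|) : hatH y = 0 := by
  simp only [hatH]; exact max_eq_left (by linarith)

/-- Support of `hatL`: `hatL y > 0 → cubo y < 1`. -/
theorem cubo_lt_one_of_hatL_pos {y : EuclideanSpace ℝ (Fin 3)} (h : 0 < hatL y) : cubo y < 1 := by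
  by_contra hc
  rw [hatL_eq_zero_of_le (not_lt.1 hc)] at h
  exact lt_irrefl _ h

/-- Support of `hatH`: `hatH y > 0 → ‖y‖₁ < 1`. -/
theorem norm1_lt_one_of_hatH_pos {y : EuclideanSpace ℝ (Fin 3)} (h : 0 < hatH y) :
    |y 0| + |y 1| + |y 2| < 1 := by
  by_contra hc
  rw [hatH_eq_zero_of_le (not_lt.1 hc)] at h
  exact lt_irrefl _ h

/-! ## Vertex values -/

/-- An integer vector with even, nonzero coordinate sum … more precisely: a NONZERO point of `D₃`
(`fccPoint d`, `d ≠ 0`) has `‖·‖₁ ≥ 2`, hence `cubo ≥ 1`. -/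
theorem one_le_cubo_intVec_fccPoint {d : Site} (hd : d ≠ 0) : 1 ≤ cubo (intVec (fccPoint d)) := by
  refine le_trans ?_ (half_le_cubo _)
  simp only [intVec_apply]
  -- the coordinates of `fccPoint d`
  have h0 : (fccPoint d 0 : ℝ) = d 0 + d 1 := by simp [fccPoint]
  have h1 : (fccPoint d 1 : ℝ) = d 0 + d 2 := by simp [fccPoint]
  have h2 : (fccPoint d 2 : ℝ) = d 1 + d 2 := by simp [fccPoint]
  rw [h0, h1, h2]
  -- integer case analysis: not all of d 0, d 1, d 2 vanish
  have hne : ¬ (d 0 = 0 ∧ d 1 = 0 ∧ d 2 = 0) := by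
    rintro ⟨a, b, c⟩; apply hd; funext i; fin_cases i <;> assumption
  have key : (2 : ℤ) ≤ |d 0 + d 1| + |d 0 + d 2| + |d 1 + d 2| := by
    rcases le_or_gt 0 (d 0 + d 1) with ha | ha <;> rcases le_or_gt 0 (d 0 + d 2) with hb | hb <;>
      rcases le_or_gt 0 (d 1 + d 2) with hc | hc <;>
      simp only [abs_of_nonneg, abs_of_neg, ha, hb, hc] <;> omega
  have key' : (2 : ℝ) ≤ |(d 0 : ℝ) + d 1| + |(d 0 : ℝ) + d 2| + |(d 1 : ℝ) + d 2| := by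
    exact_mod_cast key
  linarith

/-- `hatL` vanishes at every lattice point other than its own: `hatL (fccPoint v − fccPoint w) = [v = w]`. -/
theorem hatL_intVec_fccPoint_sub (v w : Site) :
    hatL (intVec (fccPoint v) - intVec (fccPoint w)) = if v = w then 1 else 0 := by
  split_ifs with h
  · subst h; rw [sub_self]; exact hatL_zero
  · have hsub : intVec (fccPoint v) - intVec (fccPoint w) = intVec (fccPoint (v - w)) := by
      rw [← fccPoint_sub]; ext i; simp [intVec_apply]
    rw [hsub]
    exact hatL_eq_zero_of_le (one_le_cubo_intVec_fccPoint (sub_ne_zero.2 h))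

/-- An integer vector with ODD coordinate sum has `‖·‖_∞ ≥ 1`, hence `cubo ≥ 1`: `hatL` vanishes at
every hole, `hatL (holeZ p − fccPoint w) = 0`. -/
theorem hatL_intVec_holeZ_sub (p w : Site) : hatL (intVec (holeZ p) - intVec (fccPoint w)) = 0 := by
  apply hatL_eq_zero_of_le
  have h0 : ((intVec (holeZ p) - intVec (fccPoint w)) : EuclideanSpace ℝ (Fin 3)) 0 =
      ((p 0 + p 1 + 1 - (w 0 + w 1) : ℤ) : ℝ) := by simp [intVec_apply, holeZ, fccPoint]; try ring
  have h1 : ((intVec (holeZ p) - intVec (fccPoint w)) : EuclideanSpace ℝ (Fin 3)) 1 =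
      ((p 0 + p 2 - (w 0 + w 2) : ℤ) : ℝ) := by simp [intVec_apply, holeZ, fccPoint]
  have h2 : ((intVec (holeZ p) - intVec (fccPoint w)) : EuclideanSpace ℝ (Fin 3)) 2 =
      ((p 1 + p 2 - (w 1 + w 2) : ℤ) : ℝ) := by simp [intVec_apply, holeZ, fccPoint]
  -- one of the three integer coordinates is nonzero (their signed sum is odd)
  have hnz : p 0 + p 1 + 1 - (w 0 + w 1) ≠ 0 ∨ p 0 + p 2 - (w 0 + w 2) ≠ 0 ∨
      p 1 + p 2 - (w 1 + w 2) ≠ 0 := by omega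
  have cast_one_le : ∀ z : ℤ, z ≠ 0 → (1 : ℝ) ≤ |(z : ℝ)| := fun z hz => by
    rw [← Int.cast_abs]; exact_mod_cast Int.one_le_abs hz
  rcases hnz with hz | hz | hz
  · refine le_trans ?_ (abs_le_cubo _ 0); rw [h0]; exact cast_one_le _ hz
  · refine le_trans ?_ (abs_le_cubo _ 1); rw [h1]; exact cast_one_le _ hz
  · refine le_trans ?_ (abs_le_cubo _ 2); rw [h2]; exact cast_one_le _ hz

/-- `hatH` vanishes at every lattice point: `hatH (fccPoint v − holeZ p) = 0` (odd coordinate sum). -/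
theorem hatH_intVec_fccPoint_sub (v p : Site) : hatH (intVec (fccPoint v) - intVec (holeZ p)) = 0 := by
  apply hatH_eq_zero_of_le
  have h0 : ((intVec (fccPoint v) - intVec (holeZ p)) : EuclideanSpace ℝ (Fin 3)) 0 =
      ((v 0 + v 1 - (p 0 + p 1 + 1) : ℤ) : ℝ) := by simp [intVec_apply, holeZ, fccPoint]; try ring
  have h1 : ((intVec (fccPoint v) - intVec (holeZ p)) : EuclideanSpace ℝ (Fin 3)) 1 =
      ((v 0 + v 2 - (p 0 + p 2) : ℤ) : ℝ) := by simp [intVec_apply, holeZ, fccPoint]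
  have h2 : ((intVec (fccPoint v) - intVec (holeZ p)) : EuclideanSpace ℝ (Fin 3)) 2 =
      ((v 1 + v 2 - (p 1 + p 2) : ℤ) : ℝ) := by simp [intVec_apply, holeZ, fccPoint]
  rw [h0, h1, h2, ← Int.cast_abs, ← Int.cast_abs, ← Int.cast_abs]
  have key : (1 : ℤ) ≤ |v 0 + v 1 - (p 0 + p 1 + 1)| + |v 0 + v 2 - (p 0 + p 2)| + |v 1 + v 2 - (p 1 + p 2)| := by
    rcases le_or_gt 0 (v 0 + v 1 - (p 0 + p 1 + 1)) with ha | ha <;>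
      rcases le_or_gt 0 (v 0 + v 2 - (p 0 + p 2)) with hb | hb <;>
      rcases le_or_gt 0 (v 1 + v 2 - (p 1 + p 2)) with hc | hc <;>
      simp only [abs_of_nonneg, abs_of_neg, ha, hb, hc] <;> omega
  have key' : (1 : ℝ) ≤ ((|v 0 + v 1 - (p 0 + p 1 + 1)| : ℤ) : ℝ) + ((|v 0 + v 2 - (p 0 + p 2)| : ℤ) : ℝ) +
      ((|v 1 + v 2 - (p 1 + p 2)| : ℤ) : ℝ) := by exact_mod_cast key
  linarith

/-- `hatH` is `1` at its own hole and `0` at every other hole. -/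
theorem hatH_intVec_holeZ_sub (p q : Site) :
    hatH (intVec (holeZ p) - intVec (holeZ q)) = if p = q then 1 else 0 := by
  split_ifs with h
  · subst h; rw [sub_self]; exact hatH_zero
  · apply hatH_eq_zero_of_le
    have hsub : intVec (holeZ p) - intVec (holeZ q) = intVec (fccPoint (p - q)) := by
      have hz : holeZ p - holeZ q = fccPoint (p - q) := by
        rw [← fccPoint_sub, holeZ, holeZ]; abel
      rw [← hz]; ext i; simp [intVec_apply]
    rw [hsub]
    have := one_le_cubo_intVec_fccPoint (sub_ne_zero.2 h)
    -- `cubo ≥ 1` for a nonzero `D₃` vector came from `‖·‖₁ ≥ 2`; redo the `‖·‖₁` bound directly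
    have hd : p - q ≠ 0 := sub_ne_zero.2 h
    set d := p - q with hdd
    simp only [intVec_apply]
    have h0 : (fccPoint d 0 : ℝ) = d 0 + d 1 := by simp [fccPoint]
    have h1 : (fccPoint d 1 : ℝ) = d 0 + d 2 := by simp [fccPoint]
    have h2 : (fccPoint d 2 : ℝ) = d 1 + d 2 := by simp [fccPoint]
    rw [h0, h1, h2]
    have hne : ¬ (d 0 = 0 ∧ d 1 = 0 ∧ d 2 = 0) := by
      rintro ⟨a, b, c⟩; apply hd; funext i; fin_cases i <;> assumption
    have key : (2 : ℤ) ≤ |d 0 + d 1| + |d 0 + d 2| + |d 1 + d 2| := by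
      rcases le_or_gt 0 (d 0 + d 1) with ha | ha <;> rcases le_or_gt 0 (d 0 + d 2) with hb | hb <;>
        rcases le_or_gt 0 (d 1 + d 2) with hc | hc <;>
        simp only [abs_of_nonneg, abs_of_neg, ha, hb, hc] <;> omega
    have key' : (2 : ℝ) ≤ |(d 0 : ℝ) + d 1| + |(d 0 : ℝ) + d 2| + |(d 1 : ℝ) + d 2| := by
      exact_mod_cast key
    linarith

end Summit.Ventures.Crystal3D.TentCertificate

end
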